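import Summits.BirchSwinnertonDyer.BirchSwinnertonDyer.Theorems.GenusKolyvaginAtTwoShaCardDvdPowAtTwoRTAntiSymmetrisation
import HarnessLib

/-!
# Route `GenusKolyvaginAtTwo`, crux U_T `ShaCardDvdPowAtTwoRT` (stmt-BirchSwinnertonDyer-23658), LINE 19 `rational_pair_descent` v1.1 —
# STUB SANDWICH′ `stub_sandwichOfMinimalTwin` BY NAME: `#Ш(E/K)[2^∞] ∣ 2 · #Ш(E/ℚ)[2^∞]` on U_T's frame with `w(E) = 1` and a
# 2-Selmer-minimal twin `Wd ≅ E^{(d_K)}` with `ord₂ c(Wd) ≤ 1` — UNCONDITIONAL modulo the crux's antecedent Q2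

Seat `bsd-line-gk2-p1` g19 (LEAD, cell `bsd-f1-sign2`), `--supports stmt-BirchSwinnertonDyer-23658` (registered stub of LINE 19; closes nothing by
itself).  THEOREMS ONLY (no definition, no named fact, no `sorry`).  BSD is NOT proved by any of this; U_T is NOT proved (the declared residual
`stub_residualOffMinimalTwin` — the complement of the live configuration — remains); nothing is closed.

COMPOSITION (memo `Lines/rational-pair-descent-lead-g19.md` §6c): this seat's assembly `natCard_sha_dvd_two_mul_of_inputs` (`…RTSandwichAssembly`:
`2·#X ≤ #res⁻¹(X) · #(1−τ_*)X` from «invariant classes are restrictions» `…RTInvariantClassesDescend` and the Kramer class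
`…RTRestrictionKernelNontrivial`) + (R′) `natCard_comap_resBaseChange_shaPrimary_le_onHabitat` + (A)
`natCard_map_sub_conjH1Points_shaPrimary_le_onHabitat` (`…RTAntiSymmetrisation`), with `e = ord₂ c(Wd) ≤ 1`.  With gk2-p4 g22's PAIRCOUNT
`stub_shaRatCardDvdOfMinimalTwin` (`…RTPairCount`) the live branch of `ShaCardDvdPowAtTwoRT_of_stubs` is sorry-free.

References: [Kramer1981] Thm. 1; [GrossLMS1991] §5 (5.1)–(5.3); [McCallumLMS1991] §5 Cor. 5.6; [SerreGaloisCohomology1997] I §2.4, §5.8.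
-/

set_option autoImplicit false
-- the Theorems namespace of this sub repeats the summit name by design (D-0017 nested layout)
set_option linter.dupNamespace false

noncomputable section

open scoped Classical

namespace Summit.BirchSwinnertonDyer.BirchSwinnertonDyer.Theorems.GenusExact.RationalPairDescent

open WeierstrassCurve NumberField IsDedekindDomain Field Literature.NumberTheory.EllipticCurves
  Literature.NumberTheory.GaloisRepresentations Literature.NumberTheory.EllipticCurves.ModularForms
open Literature.NumberTheory
open Summit.BirchSwinnertonDyer.BirchSwinnertonDyer.Theses.GenusKolyvaginAtTwo
open Summit.BirchSwinnertonDyer.BirchSwinnertonDyer.Theorems.GenusExact.PlusDescent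

/-- **STUB SANDWICH′ OF LINE 19 (`rational_pair_descent` v1.1), BY NAME: `#Ш(E/K)[2^∞] ∣ 2 · #Ш(E/ℚ)[2^∞]`** on U_T's frame with
`w(E) = 1` and a 2-Selmer-minimal globally minimal twin model `Wd ≅ E^{(d_K)}` with `ord₂ c(Wd) ≤ 1`.  Proof = the assembly
`natCard_sha_dvd_two_mul_of_inputs` (`2·#X ≤ #res⁻¹(X) · #(1−τ_*)X`: invariant classes are restrictions + the Kramer class) fed with
(R′) `natCard_comap_resBaseChange_shaPrimary_le_onHabitat` and (A) `natCard_map_sub_conjH1Points_shaPrimary_le_onHabitat`, `e = ord₂ c(Wd) ≤ 1`.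
UNCONDITIONAL modulo the in-signature antecedent Q2 (`KolyvaginRelationAtTwo`); Q5R, the Q1-shape clause, `hdiv` and `[Wd.IsGloballyMinimal]`
are not used.  BSD is NOT proved by this; U_T is NOT proved by this (the declared residual `stub_residualOffMinimalTwin` remains).
[cite: Kramer1981, Thm. 1] [cite: GrossLMS1991, §5 (5.1)–(5.3)] [cite: McCallumLMS1991, §5 Cor. 5.6] -/
theorem stub_sandwichOfMinimalTwin :
    KolyvaginRelationAtTwo → EquivariantChebotarevAtTwoR → (∀ (W : WeierstrassCurve ℚ) [W.IsElliptic], W.Δ < 0 → ∀ (c₀ : Field.absoluteGaloisGroup ℚ), Literature.NumberTheory.GaloisRepresentations.IsComplexConjugation (Rat.castHom ℝ) c₀ → ∀ (M : ℕ), ∃ P : W.geomTorsion ((2 ^ M : ℕ) : ℤ), ∀ Q : W.geomTorsion ((2 ^ M : ℕ) : ℤ), ∃ a b : ℤ, Q = a • P + b • (c₀ • P)) → ∀ (W : WeierstrassCurve ℚ) [W.IsElliptic] [W.IsGloballyMinimal] [NeZero (W.conductorNorm ℤ)], ¬ W.HasCM → Odd W.tamagawaProduct → ∀ (v : IsDedekindDomain.HeightOneSpectrum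 (NumberField.RingOfIntegers ℚ)), ((2 : ℕ) : NumberField.RingOfIntegers ℚ) ∉ v.asIdeal → ((W.conductorNorm ℤ : ℕ) : NumberField.RingOfIntegers ℚ) ∈ v.asIdeal → W.HasMultiplicativeReductionAt v → W.Δ < 0 → ∀ (K : Type) [Field K] [NumberField K], Literature.NumberTheory.EllipticCurves.IsImaginaryQuadratic K → Odd (NumberField.discr K) → NumberField.discr K ≠ -3 → Literature.NumberTheory.EllipticCurves.SatisfiesHeegnerHypothesis (W.conductorNorm ℤ) K → ¬ IsSquare ((NumberField.discr K : ℚ) * -|W.Δ|) → ¬ IsSquare ((NumberField.discr K : ℚ) * (-(2 * |W.Δ|))) → (∀ n : ℕ, 0 < n → W.HasSurjectiveModNGaloisRep ((2 : ℤ) ^ n)) → ∀ (Dt : Literature.NumberTheory.EllipticCurves.ModularForms.ModularParametrizationData W (W.conductorNorm ℤ)) (β : ℤ) (ι : K →+* ℂ) (d₁ : Literature.NumberTheory.EllipticCurves.KolyvaginHeegnerData Dt β ι 1), ¬ IsOfFinAddOrder d₁.derivedPoint → ∀ (M₀ : ℕ), (∃ Q : (W.baseChange (Literature.NumberTheory.EllipticCurves.ringClassField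 K ι 1)).toAffine.Point, ((2 ^ M₀ : ℕ) : ℤ) • Q = d₁.derivedPoint) → (¬ ∃ Q : (W.baseChange (Literature.NumberTheory.EllipticCurves.ringClassField K ι 1)).toAffine.Point, ((2 ^ (M₀ + 1) : ℕ) : ℤ) • Q = d₁.derivedPoint) →
      W.rootNumber = 1 → ∀ (Wd : WeierstrassCurve ℚ) [Wd.IsElliptic] [Wd.IsGloballyMinimal],
        (∃ C : WeierstrassCurve.VariableChange ℚ, C • W.quadraticTwist (NumberField.discr K : ℚ) = Wd) →
        Nat.card (Wd.selmerGroup 2) = 2 → padicValNat 2 Wd.tamagawaProduct ≤ 1 →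
        Nat.card (AddCommGroup.primaryComponent (W.baseChange K).sha 2) ∣
          2 * Nat.card (AddCommGroup.primaryComponent W.sha 2) := by
  intro hQ2 _hQ5R _hQ1 W _ _ _ hcm hT v h2v hNv hmult hneg K _ _ hIQ hodd h3 hHe hsq1 hsq2 hρ Dt β ι d₁ hy M₀ _hdiv hndiv hw Wd _ _ hWd
    hSel hDEF
  obtain ⟨Cd, hCd⟩ := hWd
  obtain ⟨σ, -, hσ1, -⟩ := exists_gal_ne_one_sqrt_discr K hIQ.1
  exact natCard_sha_dvd_two_mul_of_inputs W K hQ2 hcm hT v h2v hNv hmult hneg hIQ hodd h3 hHe hsq1 hsq2 hρ Dt β ι d₁ M₀ hndiv hw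
    hσ1 (padicValNat 2 Wd.tamagawaProduct) hDEF
    (natCard_comap_resBaseChange_shaPrimary_le_onHabitat W K hQ2 hcm hT v h2v hNv hmult hneg hIQ hodd h3 hHe hsq1 hsq2 hρ Dt β ι
      d₁ M₀ hndiv Cd hCd)
    (natCard_map_sub_conjH1Points_shaPrimary_le_onHabitat W K hQ2 hcm hT v h2v hNv hmult hneg hIQ hodd h3 hHe hsq1 hsq2 hρ Dt β ι d₁
      hy M₀ hndiv hw hσ1 Cd hCd hSel)

end Summit.BirchSwinnertonDyer.BirchSwinnertonDyer.Theorems.GenusExact.RationalPairDescent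

end
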